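import Literature.NumberTheory.EllipticCurves.ZpExtensionSplitLineProofs
import Literature.NumberTheory.EllipticCurves.ZpExtensionIdelicCharacterRankProofs
import Literature.NumberTheory.NumberFields.UnramifiedCompositum
import Literature.NumberTheory.GaloisRepresentations.LocalOneUnitsStructureProofs
import Summits.BirchSwinnertonDyer.BirchSwinnertonDyer.Theorems.TwoAdicConverseBDPSelmerLowerDivisibilityAtTwoSplitPrimePairExists
import HarnessLib

/-!
# Idelic avatars of finite-order characters of `Γ_K`; local units at unramified places; local rank ONE at a split prime
# (crux O2 `BDPSelmerLowerDivisibilityAtTwo`, stmt-BirchSwinnertonDyer-24728, line `two_variable_gv_squeeze_two`: the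
# class-field-theoretic tools for the KERNEL DISCHARGE of the print binder `Greenberg1978.splitPrime_iwasawaModule_finite_torsion`)

Cell `bsd-2adic` (home `run/shared/lean/pub/bsd-2adic/`), seat `bsd-2adic-conv-1` GEN 41; helper
`--supports stmt-BirchSwinnertonDyer-24728` (route `TwoAdicConverse`, rung S3). THEOREMS ONLY: no definition, no named fact,
no instance, no `sorry`. HONEST FRAMING: generic class field theory bookkeeping on the tree's PROVED idelic Artin map
(`ideleArtinMap`); nothing about any elliptic curve or `L`-function is asserted; O2 / 19556 / 19218 stay OPEN; BSD is proved
for no curve by any of this. First of three files (`…SplitPrimeLineRestrictionsFinite`, `…SplitPrimeIwasawaModuleTorsionHolds`).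

## What (any number field `K` unless said otherwise)

* §1 `exists_idelicCharacter` — the idelic avatar `Λ = χ^ab ∘ [·, K]` of a continuous character `χ : Γ_K → B` into ANY
  Hausdorff abelian group (the tree's `ZpExtension.exists_idelicCharacter` is `B = ℤ_p`; `Λ(Kˣ) = 1`, `Λ(K_∞ˣ) = 1` are
  one-liners from `ideleArtinMap_eq_one_of_mem_principalIdeles` / `ideleArtinMap_infiniteIdeles`); **`idelicCharacter_localUnits_eq_one_of_forall_inertia_le`**: if `ker χ` is OPEN and contains every
  inertia group above the finite place `w`, then `Λ(⟨𝒪_wˣ⟩_w) = 1` — through the finite ABELIAN layer `E = K̄^{ker χ}`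
  (infinite Galois correspondence), unramified at `w` (Neukirch VII §10), and Tate VII 4.2 (iii)
  (`abRestrict_ideleArtinMap_localUnits_integer`).
* §2 `idelicCharacter_localUnits_eq_one_of_ne` — the same for `χ` killing the CHOSEN inertia groups `GreenbergSelmer.inertia w`,
  `w ≠ v` (dictionary `TwoAdicBDPSplitPrimePair.inertiaOutside_subset_iff_forall_inertia_le`, p772855).
* §3 `apply_eq_apply_localUnits_of_mem_unitIdeles` — an idele character killing `K_∞ˣ` and the local units at all `w ≠ v`
  sees a unit idele only through its `v`-component (`IdelicCharacter.map_eq_one_of_forall_valued_eq_one`).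
* §4 `natCard_quot_adicCompletionIntegers_eq_of_split` (`#(𝒪_v/p) = p` at a split prime of a quadratic field) and
  **`finite_setOf_apply_eq_one_of_natCard_quot_eq`**: there a non-trivial continuous `ψ : 𝒪_vˣ → ℤ_p` has FINITE kernel
  (`U₂ ≅ ℤ_p` open of finite index, `OneUnits.exists_subgroup_continuousMulEquiv`).

References: [Lang1990] Ch. 5 §5 Thm. 5.1; [Washington1997] §13.1 (proof of Thm. 13.4); [NeukirchANT1999] II (5.7), VI (6.1),
VII §10; [CasselsFrohlichANT1967] VII §4.2, 5.4; [Shimura1998] §18.3; [Greenberg1978] §4.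
-/

-- D-0017: single-problem summit, the namespace repeats the problem name by design.
set_option linter.dupNamespace false
set_option autoImplicit false

noncomputable section

open scoped Classical

open NumberField IsDedekindDomain Field
open Literature.NumberTheory.GaloisRepresentations Literature.NumberTheory.NumberFields
  Literature.NumberTheory.EllipticCurves

namespace Summit.BirchSwinnertonDyer.BirchSwinnertonDyer.Theorems.TwoAdicBDPSplitPrimeTorsion

variable {K : Type} [Field K] [NumberField K]

/-! ## §1 The idelic avatar of a continuous character of `Γ_K` with Hausdorff abelian values -/

section Avatar

variable {B : Type*} [CommGroup B] [TopologicalSpace B]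

/-- **The idelic avatar `Λ = χ^ab ∘ [·, K]` of a continuous character `χ : Γ_K → B`** into a Hausdorff abelian
group: `χ` kills the closed commutator subgroup, hence factors through `Γ_K^ab`; composed with Shimura's
`[·, K] : 𝕀_K → Γ_K^ab` (`ideleArtinMap`) it gives a continuous character `Λ` of the idele group with
`Λ a = χ γ` whenever `[a, K] = γ|_{K^ab}` (verbatim the tree's `ZpExtension.exists_idelicCharacter`, which is the
case `B = ℤ_p`). [cite: NeukirchANT1999, Ch. VI §6 Thm. (6.1)] -/
theorem exists_idelicCharacter [T2Space B] (χ : absoluteGaloisGroup K →ₜ* B) :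
    ∃ Λ : ideleGroup K →ₜ* B,
      ∀ (a : ideleGroup K) (γ : absoluteGaloisGroup K),
        absGaloisAbProj K γ = ideleArtinMap K a → Λ a = χ γ := by
  have hle : (commutator (absoluteGaloisGroup K)).topologicalClosure ≤ χ.toMonoidHom.ker := by
    refine Subgroup.topologicalClosure_minimal _ (Abelianization.commutator_subset_ker χ.toMonoidHom) ?_
    change IsClosed (χ ⁻¹' {1})
    exact (isClosed_singleton (x := (1 : B))).preimage (map_continuous χ)
  set χab : absoluteGaloisGroupAbelianization K →* B := QuotientGroup.lift _ χ.toMonoidHom hle with hχab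
  have hχabc : Continuous χab := by
    refine (QuotientGroup.isQuotientMap_mk _).continuous_iff.mpr ?_
    exact map_continuous χ
  refine ⟨⟨χab.comp (ideleArtinMap K), hχabc.comp (continuous_ideleArtinMap K)⟩, fun a γ h ↦ ?_⟩
  change χab (ideleArtinMap K a) = χ γ
  rw [← h]
  rfl

variable {χ : absoluteGaloisGroup K →ₜ* B} {Λ : ideleGroup K →ₜ* B}
  (hΛ : ∀ (a : ideleGroup K) (γ : absoluteGaloisGroup K), absGaloisAbProj K γ = ideleArtinMap K a → Λ a = χ γ)
include hΛ

/-- **Local units at a place where `χ` is unramified die under `Λ`.** If the kernel of `χ` is OPEN (e.g. `B`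
discrete) and contains the inertia groups `I(𝔓 | w) ≤ Γ_K` of all primes `𝔓` of `K̄` above the finite place `w`,
then `Λ(⟨𝒪_wˣ⟩_w) = 1`: the finite abelian layer `E = K̄^{ker χ}` is unramified at `w` (Neukirch VII §10, tree
`isUnramifiedIn_iff_forall_inertia_absRestrictNormalHom_eq_one`), so `[⟨u⟩_w, K]|_E = ψ_{E|K}(⟨u⟩_w) = 1` (Tate VII
4.2 (iii), tree `abRestrict_ideleArtinMap_localUnits_integer`), i.e. any representative of `[⟨u⟩_w, K]` lies in
`Gal(K̄/E) = ker χ`. [cite: CasselsFrohlichANT1967, Ch. VII §4.2 Corollary (iii)] [cite: NeukirchANT1999, Ch. VII §10 Thm. (10.6) (proof)] -/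
theorem idelicCharacter_localUnits_eq_one_of_forall_inertia_le
    (hopen : IsOpen (((χ : absoluteGaloisGroup K →* B).ker : Subgroup (absoluteGaloisGroup K)) :
      Set (absoluteGaloisGroup K)))
    {w : HeightOneSpectrum (𝓞 K)}
    (hI : ∀ 𝔓 ∈ w.primesAbove, ∀ g ∈ 𝔓.inertia (absoluteGaloisGroup K), χ g = 1)
    (u : (w.adicCompletionIntegers K)ˣ) :
    Λ (localUnits w (Units.map ((w.adicCompletionIntegers K).subtype : _ →* _) u)) = 1 := by
  classical
  set N : Subgroup (absoluteGaloisGroup K) := (χ : absoluteGaloisGroup K →* B).ker with hN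
  haveI hNn : N.Normal := by rw [hN]; infer_instance
  have hc : IsClosed (N : Set (absoluteGaloisGroup K)) := N.isClosed_of_isOpen hopen
  let N' : ClosedSubgroup (AlgebraicClosure K ≃ₐ[K] AlgebraicClosure K) :=
    ⟨(N : Subgroup (AlgebraicClosure K ≃ₐ[K] AlgebraicClosure K)), hc⟩
  set E : IntermediateField K (AlgebraicClosure K) := IntermediateField.fixedField N'.1 with hE
  have hfix : E.fixingSubgroup = N'.1 := InfiniteGalois.fixingSubgroup_fixedField N'
  haveI : FiniteDimensional K E := by
    rw [← InfiniteGalois.isOpen_iff_finite, hfix]; exact hopen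
  haveI : IsGalois K E := by
    rw [← InfiniteGalois.normal_iff_isGalois, hfix]; exact hNn
  haveI : NumberField E := NumberField.of_module_finite K E
  -- `g|_E = 1 ↔ χ g = 1`
  have hker : ∀ g : absoluteGaloisGroup K, absRestrictNormalHom E g = 1 ↔ χ g = 1 := fun g ↦ by
    rw [absRestrictNormalHom_eq_one_iff_forall_smul]
    have h1 : (∀ x : E, g • (x : AlgebraicClosure K) = x) ↔
        absoluteGaloisGroup.toAlgEquiv K g ∈ E.fixingSubgroup := by
      rw [IntermediateField.mem_fixingSubgroup_iff]
      exact ⟨fun h x hx ↦ h ⟨x, hx⟩, fun h x ↦ h x x.2⟩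
    rw [h1, hfix]
    exact MonoidHom.mem_ker
  -- `E/K` is abelian: `Gal(E/K)` is a quotient of `Γ_K / ker χ ↪ B`
  haveI : IsAbelianGalois K E :=
    { is_comm := ⟨fun a b ↦ by
        obtain ⟨σ, rfl⟩ : ∃ σ : absoluteGaloisGroup K, absRestrictNormalHom E σ = a := by
          obtain ⟨σ, hσ⟩ := AlgEquiv.restrictNormalHom_surjective (AlgebraicClosure K) a
          exact ⟨(absoluteGaloisGroup.toAlgEquiv K).symm σ, hσ⟩
        obtain ⟨τ, rfl⟩ : ∃ τ : absoluteGaloisGroup K, absRestrictNormalHom E τ = b := by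
          obtain ⟨τ, hτ⟩ := AlgEquiv.restrictNormalHom_surjective (AlgebraicClosure K) b
          exact ⟨(absoluteGaloisGroup.toAlgEquiv K).symm τ, hτ⟩
        rw [← map_mul, ← map_mul, ← mul_inv_eq_one, ← map_inv, ← map_mul, hker, map_mul, map_inv,
          map_mul, map_mul, mul_inv_eq_one, mul_comm]⟩ }
  -- `E` is unramified at `w`
  have hunr : Algebra.IsUnramifiedIn (𝓞 E) w.asIdeal :=
    (isUnramifiedIn_iff_forall_inertia_absRestrictNormalHom_eq_one E w).mpr
      fun 𝔓 h𝔓 g hg ↦ (hker g).mpr (hI 𝔓 h𝔓 g hg)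
  obtain ⟨γ₀, hγ₀⟩ := QuotientGroup.mk_surjective
    (ideleArtinMap K (localUnits w (Units.map ((w.adicCompletionIntegers K).subtype : _ →* _) u)))
  have hγ₀' : absGaloisAbProj K γ₀ =
      ideleArtinMap K (localUnits w (Units.map ((w.adicCompletionIntegers K).subtype : _ →* _) u)) := hγ₀
  rw [hΛ _ γ₀ hγ₀', ← hker, ← abRestrict_absGaloisAbProj E γ₀, hγ₀']
  exact abRestrict_ideleArtinMap_localUnits_integer E hunr u

end Avatar

/-! ## §2 Characters unramified outside ONE place `v`: the local units at every `w ≠ v` die -/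

section UnramifiedOutside

variable {B : Type*} [CommGroup B] [TopologicalSpace B]
  {χ : absoluteGaloisGroup K →ₜ* B} {Λ : ideleGroup K →ₜ* B}
  (hΛ : ∀ (a : ideleGroup K) (γ : absoluteGaloisGroup K), absGaloisAbProj K γ = ideleArtinMap K a → Λ a = χ γ)
include hΛ

/-- **`Λ(⟨𝒪_wˣ⟩_w) = 1` at every finite `w ≠ v` for a character with OPEN kernel killing the chosen inertia groups
`I_w = GreenbergSelmer.inertia w`, `w ≠ v`.** The kernel is normal, so it contains every inertia group `I(𝔓 | w)`
of every prime `𝔓` of `K̄` above `w` (tree dictionary `TwoAdicBDPSplitPrimePair.inertiaOutside_subset_iff_forall_inertia_le`,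
Neukirch I (9.1): the inertia groups above `w` are conjugate), and `idelicCharacter_localUnits_eq_one_of_forall_inertia_le`
applies. [cite: CasselsFrohlichANT1967, Ch. VII §4.2 Corollary (iii)] [cite: NeukirchANT1999, Ch. I §9 Prop. (9.1)] -/
theorem idelicCharacter_localUnits_eq_one_of_ne
    (hopen : IsOpen (((χ : absoluteGaloisGroup K →* B).ker : Subgroup (absoluteGaloisGroup K)) :
      Set (absoluteGaloisGroup K)))
    {v : HeightOneSpectrum (𝓞 K)}
    (hχ : ∀ w : HeightOneSpectrum (𝓞 K), w ≠ v → GreenbergSelmer.inertia w ≤ (χ : absoluteGaloisGroup K →* B).ker)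
    {w : HeightOneSpectrum (𝓞 K)} (hw : w ≠ v) (u : (w.adicCompletionIntegers K)ˣ) :
    Λ (localUnits w (Units.map ((w.adicCompletionIntegers K).subtype : _ →* _) u)) = 1 := by
  haveI : ((χ : absoluteGaloisGroup K →* B).ker).Normal := inferInstance
  have hsub := (TwoAdicBDPSplitPrimePair.inertiaOutside_subset_iff_forall_inertia_le ({v} : Set (HeightOneSpectrum (𝓞 K)))
    ((χ : absoluteGaloisGroup K →* B).ker)).mpr fun w' hw' ↦ hχ w' (by simpa using hw')
  refine idelicCharacter_localUnits_eq_one_of_forall_inertia_le hΛ hopen (w := w) (fun 𝔓 h𝔓 g hg ↦ ?_) u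
  have hmem : g ∈ Literature.NumberTheory.FaltingsSerre.inertiaOutside K ({v} : Set (HeightOneSpectrum (𝓞 K))) :=
    ⟨w, by simpa using hw, 𝔓, h𝔓, hg⟩
  exact (MonoidHom.mem_ker).mp (hsub hmem)

end UnramifiedOutside

/-! ## §3 Idele class characters trivial on the local units away from `v` -/

section Admissible

variable {M : Type*} [CommGroup M] [TopologicalSpace M] [T2Space M] (Φ : ideleGroup K →ₜ* M)
  (v : HeightOneSpectrum (𝓞 K))
  (hI : ∀ y : (InfiniteAdeleRing K)ˣ, Φ (infiniteIdeles K y) = 1)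
  (hU : ∀ w : HeightOneSpectrum (𝓞 K), w ≠ v → ∀ u : (w.adicCompletionIntegers K)ˣ,
    Φ (localUnits w (Units.map ((w.adicCompletionIntegers K).subtype : _ →* _) u)) = 1)
include hI hU

/-- **A continuous idele character killing `K_∞ˣ` and the local units at every `w ≠ v` sees a unit idele only
through its `v`-component**: `Φ(u) = Φ(⟨u_v⟩_v)` for `u ∈ 𝕌_K` (strip the archimedean part; `u · ⟨u_v⟩_v⁻¹`
is supported on units away from `v`, killed by continuity — tree `IdelicCharacter.map_eq_one_of_forall_valued_eq_one`).
[cite: CasselsFrohlichANT1967, Ch. VII §4, proof of Prop. 4.1] [cite: NeukirchANT1999, Ch. VI §1] -/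
theorem apply_eq_apply_localUnits_of_mem_unitIdeles {y : ideleGroup K} (hy : y ∈ unitIdeles K) :
    Φ y = Φ (localUnits v (Units.map ((v.adicCompletionIntegers K).subtype : _ →* _)
      (unitIdeles.localUnit v ⟨y, hy⟩))) := by
  classical
  -- strip the archimedean component
  set yinf : (InfiniteAdeleRing K)ˣ :=
    Units.map (RingHom.fst (InfiniteAdeleRing K) (FiniteAdeleRing (𝓞 K) K)).toMonoidHom y with hyinf
  set y₁ : ideleGroup K := y * (infiniteIdeles K yinf)⁻¹ with hy₁
  have hy₁1 : (y₁ : AdeleRing (𝓞 K) K).1 = 1 := by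
    rw [hy₁, ideleGroup_val_fst_mul]
    have h1 : (((infiniteIdeles K yinf)⁻¹ : ideleGroup K) : AdeleRing (𝓞 K) K).1 *
        ((infiniteIdeles K yinf : ideleGroup K) : AdeleRing (𝓞 K) K).1 = 1 :=
      ideleGroup_val_inv_fst_mul _
    have h2 : ((infiniteIdeles K yinf : ideleGroup K) : AdeleRing (𝓞 K) K).1 =
        (y : AdeleRing (𝓞 K) K).1 := rfl
    rw [h2] at h1
    rw [mul_comm]; exact h1
  have hy₁2 : ∀ w, (y₁ : AdeleRing (𝓞 K) K).2 w = (y : AdeleRing (𝓞 K) K).2 w := fun w ↦ by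
    rw [hy₁, ideleGroup_val_snd_mul, ideleGroup_val_inv_snd]
    have : ((infiniteIdeles K yinf : ideleGroup K) : AdeleRing (𝓞 K) K).2 w = 1 := rfl
    rw [this, inv_one, mul_one]
  -- the local unit at `v`
  set uv : (v.adicCompletion K)ˣ :=
    Units.map ((v.adicCompletionIntegers K).subtype : _ →* _) (unitIdeles.localUnit v ⟨y, hy⟩) with huv
  have huv_val : ((uv : (v.adicCompletion K)ˣ) : v.adicCompletion K) = (y : AdeleRing (𝓞 K) K).2 v := rfl
  -- `z = y₁ · ⟨u_v⟩_v⁻¹` is supported on units away from `v`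
  set z : ideleGroup K := y₁ * (localUnits v uv)⁻¹ with hz
  have hz1 : (z : AdeleRing (𝓞 K) K).1 = 1 := by
    rw [hz, ideleGroup_val_fst_mul, hy₁1, one_mul]
    have h := ideleGroup_val_inv_fst_mul (localUnits v uv)
    rwa [localUnits_fst, mul_one] at h
  have hzv : ∀ w ∈ ({v} : Set (HeightOneSpectrum (𝓞 K))), (z : AdeleRing (𝓞 K) K).2 w = 1 := by
    intro w hw
    rw [Set.mem_singleton_iff] at hw
    subst hw
    rw [hz, ideleGroup_val_snd_mul, ideleGroup_val_inv_snd, localUnits_snd_apply_self, huv_val, hy₁2,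
      mul_inv_cancel₀ (ideleGroup_snd_ne_zero y w)]
  have hzu : ∀ w, Valued.v ((z : AdeleRing (𝓞 K) K).2 w) = 1 := by
    intro w
    by_cases hw : w = v
    · rw [hzv w (by simp [hw]), map_one]
    · rw [hz, ideleGroup_val_snd_mul, ideleGroup_val_inv_snd, localUnits_snd_apply_of_ne _ hw, inv_one,
        mul_one, hy₁2]
      exact hy w
  have hΦz : Φ z = 1 :=
    IdelicCharacter.map_eq_one_of_forall_valued_eq_one Φ (S := ({v} : Set (HeightOneSpectrum (𝓞 K))))
      (fun w hw u ↦ hU w (by simpa using hw) u) z hz1 hzv hzu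
  have hyz : y = z * localUnits v uv * infiniteIdeles K yinf := by
    rw [hz, inv_mul_cancel_right, hy₁, inv_mul_cancel_right]
  rw [hyz, map_mul, map_mul, hΦz, one_mul, hI, mul_one]

end Admissible

/-! ## §4 Local rank ONE at a split prime: non-trivial `ℤ_p`-valued characters of `𝒪_vˣ` have finite kernel -/

section LocalRankOne

variable {p : ℕ} [Fact p.Prime]

/-- **`#(𝒪_v/p𝒪_v) = p` at a split prime of a quadratic field** (`n_v = [K_v : ℚ_p] = 1`): both `v` and `v̄`
contribute `n ≥ 1` to `∑_{u ∣ p} n_u = [K : ℚ] = 2` (tree `ZpExtension.exists_localRanks`).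
[cite: NeukirchANT1999, Ch. II §5 Prop. (5.7)] [cite: Washington1997, §13.1 (proof of Thm. 13.4)] -/
theorem natCard_quot_adicCompletionIntegers_eq_of_split (hK2 : Module.finrank ℚ K = 2)
    {v vbar : HeightOneSpectrum (𝓞 K)} (hv : ((p : ℕ) : 𝓞 K) ∈ v.asIdeal)
    (hvbar : ((p : ℕ) : 𝓞 K) ∈ vbar.asIdeal) (hne : vbar ≠ v) :
    Nat.card (v.adicCompletionIntegers K ⧸ Ideal.span {(p : v.adicCompletionIntegers K)}) = p := by
  classical
  obtain ⟨T, n, N, φ, hT, hsum, hnφ⟩ := ZpExtension.exists_localRanks (K := K) (p := p)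
  rw [hK2] at hsum
  have hv1 : 1 ≤ n v := ZpExtension.one_le_of_natCard_quot_adicCompletionIntegers_eq_pow hv (hnφ v hv).1
  have hvbar1 : 1 ≤ n vbar :=
    ZpExtension.one_le_of_natCard_quot_adicCompletionIntegers_eq_pow hvbar (hnφ vbar hvbar).1
  have hle : n v + n vbar ≤ ∑ w ∈ T, n w := by
    have hsub : ({v, vbar} : Finset (HeightOneSpectrum (𝓞 K))) ⊆ T := by
      intro w hw
      rw [Finset.mem_insert, Finset.mem_singleton] at hw
      rcases hw with rfl | rfl
      · exact (hT _).1 hv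
      · exact (hT _).1 hvbar
    rw [← Finset.sum_pair hne.symm]
    exact Finset.sum_le_sum_of_subset hsub
  have hnv : n v = 1 := by omega
  rw [(hnφ v hv).1, hnv, pow_one]

/-- **At a place with `#(𝒪_v/p) = p` a non-trivial continuous `ψ : 𝒪_vˣ → ℤ_p` has FINITE kernel**: the one-units
`U₂ = 1 + p²𝒪_v` are open of finite index and `≃ ℤ_p` (tree `OneUnits.exists_subgroup_continuousMulEquiv`, Neukirch
II (5.7)); a character of `ℤ_p` is `x ↦ c x` (`ZpExtension.addMonoidHom_pi_padicInt_apply_eq_sum`), and `c ≠ 0` since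
`ψ` is non-trivial on the finite-index subgroup `U₂` (`ℤ_p` is torsion-free); so `ker ψ ∩ U₂ = 1` and
`ker ψ ↪ 𝒪_vˣ/U₂`. [cite: NeukirchANT1999, Ch. II §5 Prop. (5.7)] [cite: Washington1997, §13.1 (proof of Thm. 13.4)] -/
theorem finite_setOf_apply_eq_one_of_natCard_quot_eq {v : HeightOneSpectrum (𝓞 K)}
    (hv : ((p : ℕ) : 𝓞 K) ∈ v.asIdeal)
    (hcard : Nat.card (v.adicCompletionIntegers K ⧸ Ideal.span {(p : v.adicCompletionIntegers K)}) = p)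
    (ψ : (v.adicCompletionIntegers K)ˣ →ₜ* Multiplicative ℤ_[p]) (hψ : ψ ≠ 1) :
    Set.Finite {u : (v.adicCompletionIntegers K)ˣ | ψ u = 1} := by
  classical
  have hp : p.Prime := Fact.out
  haveI : CompactSpace (v.adicCompletionIntegers K) :=
    Literature.NumberTheory.Automorphic.compactSpace_adicCompletionIntegers' K v
  have hp' : ((p : ℕ) : 𝓞 K) ∈ v.asIdeal := hv
  have hopen : ∀ m : ℕ, IsOpen ((Ideal.span {(p : v.adicCompletionIntegers K) ^ m} :
      Ideal (v.adicCompletionIntegers K)) : Set (v.adicCompletionIntegers K)) := fun m ↦ by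
    refine IsDedekindDomain.isOpen_of_ne_bot ?_
    rw [Ne, Ideal.span_singleton_eq_bot]
    exact pow_ne_zero _ (OneUnits.natCast_ne_zero_adicCompletionIntegers K v p)
  obtain ⟨n, W, hn, -, -, hWfi, ⟨e⟩⟩ := OneUnits.exists_subgroup_continuousMulEquiv p
    (A := v.adicCompletionIntegers K)
    (fun a ha ↦ (mul_eq_zero.1 ha).resolve_left (OneUnits.natCast_ne_zero_adicCompletionIntegers K v p))
    (OneUnits.isUnit_one_add_natCast_mul K v p hp') hopen
    (OneUnits.eq_zero_of_forall_mem_span_pow K v p hp')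
  have hpn : p ^ n = p ^ 1 := by rw [← hn, hcard, pow_one]
  have hn1 : n = 1 := Nat.pow_right_injective hp.two_le hpn
  subst hn1
  haveI := hWfi
  -- `ψ` on `W ≃ ℤ_p`, additively
  let f : Multiplicative (Fin 1 → ℤ_[p]) →* Multiplicative ℤ_[p] :=
    (ψ : (v.adicCompletionIntegers K)ˣ →* Multiplicative ℤ_[p]).comp (W.subtype.comp e.symm.toMonoidHom)
  let g : (Fin 1 → ℤ_[p]) →+ ℤ_[p] := MonoidHom.toAdditive f
  have hg : ∀ x : Fin 1 → ℤ_[p], g x = x 0 * g (Pi.single 0 1) := fun x ↦ by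
    rw [ZpExtension.addMonoidHom_pi_padicInt_apply_eq_sum g x, Fin.sum_univ_one]
  have hgf : ∀ w : W, g (Multiplicative.toAdd (e w)) = (ψ (w : (v.adicCompletionIntegers K)ˣ)).toAdd := fun w ↦ by
    change (f (Multiplicative.ofAdd (Multiplicative.toAdd (e w)))).toAdd = _
    rw [ofAdd_toAdd]
    change (ψ ((W.subtype (e.symm (e w))))).toAdd = _
    rw [ContinuousMulEquiv.symm_apply_apply]
    rfl
  -- the constant `c = g(e₀)` is non-zero, else `ψ` kills the finite-index subgroup `W`, hence everything
  have hc : g (Pi.single 0 1) ≠ 0 := by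
    intro hc
    apply hψ
    have hW : ∀ w : W, ψ (w : (v.adicCompletionIntegers K)ˣ) = 1 := fun w ↦ by
      apply Multiplicative.toAdd.injective
      rw [toAdd_one, ← hgf w, hg, hc, mul_zero]
    ext u
    show ψ u = 1
    have hpow : u ^ W.index ∈ W := Subgroup.pow_index_mem W u
    have h1 : ψ u ^ W.index = 1 := by rw [← map_pow]; exact hW ⟨_, hpow⟩
    apply Multiplicative.toAdd.injective
    have h2 : (W.index : ℤ_[p]) * (ψ u).toAdd = 0 := by
      rw [← nsmul_eq_mul, ← toAdd_pow, h1, toAdd_one]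
    rw [mul_eq_zero] at h2
    rw [toAdd_one]
    exact h2.resolve_left (by exact_mod_cast Subgroup.FiniteIndex.index_ne_zero)
  -- `ker ψ ∩ W = 1`
  have hker : ∀ w ∈ W, ψ w = 1 → w = 1 := by
    intro w hw hψw
    have h1 : g (Multiplicative.toAdd (e ⟨w, hw⟩)) = 0 := by
      rw [hgf ⟨w, hw⟩, hψw, toAdd_one]
    rw [hg] at h1
    have h2 : Multiplicative.toAdd (e ⟨w, hw⟩) 0 = 0 := (mul_eq_zero.1 h1).resolve_right hc
    have h3 : e ⟨w, hw⟩ = 1 := by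
      apply Multiplicative.toAdd.injective
      funext i
      rw [Fin.fin_one_eq_zero i, h2]
      rfl
    have h4 : (⟨w, hw⟩ : W) = 1 := by
      rw [← e.symm_apply_apply ⟨w, hw⟩, h3, map_one]
    exact congrArg Subtype.val h4
  -- `ker ψ ↪ 𝒪_vˣ / W`, a finite set
  haveI : Finite ((v.adicCompletionIntegers K)ˣ ⧸ W) := Subgroup.finite_quotient_of_finiteIndex
  refine Set.finite_coe_iff.mp (Finite.of_injective
    (fun u : {u : (v.adicCompletionIntegers K)ˣ | ψ u = 1} ↦ (QuotientGroup.mk (s := W) u.1)) ?_)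
  intro u u' h
  have hmem : (u.1)⁻¹ * u'.1 ∈ W := QuotientGroup.eq.mp h
  have hψ1 : ψ ((u.1)⁻¹ * u'.1) = 1 := by
    have hu : ψ u.1 = 1 := u.2
    have hu' : ψ u'.1 = 1 := u'.2
    rw [map_mul, map_inv, hu, hu', inv_one, one_mul]
  have := hker _ hmem hψ1
  exact Subtype.ext (inv_mul_eq_one.mp this)

end LocalRankOne

end Summit.BirchSwinnertonDyer.BirchSwinnertonDyer.Theorems.TwoAdicBDPSplitPrimeTorsion

end
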